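import Literature.NumberTheory.GaloisCohomology.LocalInvariantMapEvaluation
import Literature.AnabelianGeometry.AbsoluteAnabelian.AbsAnabProp121viiLevelCompatProofs
import HarnessLib

/-!
# The local invariant maps under change of level `μₙ ⊆ μ_N`
# (Serre, *Corps locaux* XIII §3: `H²(K_v, μₙ) = Br(K_v)[n] = (1/n)ℤ/ℤ ⊆ ℚ/ℤ`)

For a finite place `v` of a number field `K` and `n ∣ N`, the invariant maps
`inv_v^{(n)} : H²(K_v, μₙ) ⥲ ℤ/n` and `inv_v^{(N)} : H²(K_v, μ_N) ⥲ ℤ/N` of the tree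
(`localInvariantMap K n v`, THE residue maps `Prop121vii.invLevel`) are the restrictions of one map
`Br(K_v) ⥲ ℚ/ℤ`: read in `ℚ/ℤ` through `k ↦ k/n` (`Prop121vii.zmodToQmodZ`), the invariant of a class
`x ∈ H²(Γ_K, μₙ)` localised at `v` equals that of its image under `H²(μₙ) → H²(μ_N)`
(`cohomologyMap (muInclHom K h) 2`):

* `zmodToQmodZ_localInvariantMap_localization_muInclHom` — the compatibility (from the tree's level
  compatibility of THE residue maps, `Prop121vii.invariantMap_muInclHom_compat_addCircle`, the
  naturality `Prop121vii.resMu_cohomologyMap_muInclHom`, and the dictionary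
  `localInvariantMap_localization`);
* `localInvariantMap_localization_muInclHom_eq_zero_iff`, `sum_localInvariantMap_localization_muInclHom_eq_zero_iff`
  — vanishing of one invariant, resp. of a sum of invariants, is insensitive to the level.

Used in the tree's discharge of `poitouTate_sum_localTatePairing_eq_zero` to move classes between
levels (primary decomposition, level raising of auxiliary cyclic classes).  Theorems only (D-0026).

## References

* J.-P. Serre, *Corps locaux* / *Local Fields* (1979), XIII §3 (Prop. 6–7, Cor. 1–3). [SerreLocalFields1979]
* J. S. Milne, *Arithmetic Duality Theorems*, 2nd ed. (2006), I §1. [MilneADT2006]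
-/

noncomputable section

open CategoryTheory Function NumberField IsDedekindDomain Field
open scoped NumberField

universe u

namespace Literature.NumberTheory.GaloisCohomology

open _root_.ContinuousCohomology
open Literature.NumberTheory.GaloisRepresentations
open Literature.NumberTheory.GaloisRepresentations.DiscreteGaloisModule
open Literature.AnabelianGeometry.AbsoluteAnabelian
open Literature.AnabelianGeometry.AbsoluteAnabelian.Prop121vii

variable {K : Type u} [Field K] [NumberField K] {n N : ℕ} [NeZero n] [NeZero N] (h : n ∣ N)
  (v : HeightOneSpectrum (𝓞 K))

/-- **Level compatibility of the local invariants, read in `ℚ/ℤ`**: for `x ∈ H²(Γ_K, μₙ)` and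
`n ∣ N`, `inv_v^{(N)}(loc_v (ι_* x)) / N = inv_v^{(n)}(loc_v x) / n` in `ℚ/ℤ`, `ι : μₙ ⊆ μ_N`.
[cite: SerreLocalFields1979, XIII §3 Cor. 3] -/
theorem zmodToQmodZ_localInvariantMap_localization_muInclHom (x : galoisCohomology (mu K n) 2) :
    haveI : CompactSpace (absoluteGaloisGroup K) := absoluteGaloisGroup_compactSpace K
    zmodToQmodZ N (localInvariantMap K N v
        (galoisCohomology.localization (mu K N) (Sum.inr v) 2 (cohomologyMap (muInclHom K h) 2 x))) =
      zmodToQmodZ n (localInvariantMap K n v (galoisCohomology.localization (mu K n) (Sum.inr v) 2 x)) := by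
  haveI : CompactSpace (absoluteGaloisGroup K) := absoluteGaloisGroup_compactSpace K
  haveI : CompactSpace (absoluteGaloisGroup (v.adicCompletion K)) :=
    absoluteGaloisGroup_compactSpace (v.adicCompletion K)
  haveI : CharZero (v.adicCompletion K) := charZero_adicCompletion v
  rw [localInvariantMap_localization, localInvariantMap_localization]
  change zmodToQmodZ N (invLevel (v.adicCompletion K) N (resMu K (v.adicCompletion K) N 2
      (cohomologyMap (muInclHom K h) 2 x))) = _
  rw [resMu_cohomologyMap_muInclHom K (v.adicCompletion K) h x, zmodToQmodZ_apply, zmodToQmodZ_apply]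
  exact invariantMap_muInclHom_compat_addCircle (v.adicCompletion K) h _ _
    (isInvariantMap_invLevel _ n) (isInvariantMap_invLevel _ N) _

/-- Vanishing of the local invariant of a class is insensitive to the level at which it is read.
[cite: SerreLocalFields1979, XIII §3 Cor. 3] -/
theorem localInvariantMap_localization_muInclHom_eq_zero_iff (x : galoisCohomology (mu K n) 2) :
    haveI : CompactSpace (absoluteGaloisGroup K) := absoluteGaloisGroup_compactSpace K
    localInvariantMap K N v
        (galoisCohomology.localization (mu K N) (Sum.inr v) 2 (cohomologyMap (muInclHom K h) 2 x)) = 0 ↔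
      localInvariantMap K n v (galoisCohomology.localization (mu K n) (Sum.inr v) 2 x) = 0 := by
  rw [← (zmodToQmodZ_injective N).eq_iff, ← (zmodToQmodZ_injective n).eq_iff, map_zero, map_zero,
    zmodToQmodZ_localInvariantMap_localization_muInclHom h v x]

/-- Vanishing of the localisation of a class is insensitive to the level at which it is read
(`inv_v` is bijective at both levels). [cite: SerreLocalFields1979, XIII §3 Cor. 3] -/
theorem localization_muInclHom_eq_zero_iff (x : galoisCohomology (mu K n) 2) :
    haveI : CompactSpace (absoluteGaloisGroup K) := absoluteGaloisGroup_compactSpace K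
    galoisCohomology.localization (mu K N) (Sum.inr v) 2 (cohomologyMap (muInclHom K h) 2 x) = 0 ↔
      galoisCohomology.localization (mu K n) (Sum.inr v) 2 x = 0 := by
  haveI : CompactSpace (absoluteGaloisGroup K) := absoluteGaloisGroup_compactSpace K
  rw [← (localInvariantMap_bijective (K := K) (n := N) v).1.eq_iff,
    ← (localInvariantMap_bijective (K := K) (n := n) v).1.eq_iff, map_zero, map_zero]
  exact localInvariantMap_localization_muInclHom_eq_zero_iff h v x

/-- **Sums of local invariants are insensitive to the level**: for a finite set `S` of finite places,
`∑_{v ∈ S} inv_v^{(N)}(loc_v (ι_* x)) = 0 ↔ ∑_{v ∈ S} inv_v^{(n)}(loc_v x) = 0`.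
[cite: SerreLocalFields1979, XIII §3 Cor. 3] -/
theorem sum_localInvariantMap_localization_muInclHom_eq_zero_iff (S : Finset (HeightOneSpectrum (𝓞 K)))
    (x : galoisCohomology (mu K n) 2) :
    haveI : CompactSpace (absoluteGaloisGroup K) := absoluteGaloisGroup_compactSpace K
    ∑ v ∈ S, localInvariantMap K N v
        (galoisCohomology.localization (mu K N) (Sum.inr v) 2 (cohomologyMap (muInclHom K h) 2 x)) = 0 ↔
      ∑ v ∈ S, localInvariantMap K n v (galoisCohomology.localization (mu K n) (Sum.inr v) 2 x) = 0 := by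
  rw [← (zmodToQmodZ_injective N).eq_iff, ← (zmodToQmodZ_injective n).eq_iff, map_zero, map_zero,
    map_sum, map_sum]
  rw [Finset.sum_congr rfl fun v _ => zmodToQmodZ_localInvariantMap_localization_muInclHom h v x]

end Literature.NumberTheory.GaloisCohomology

end
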